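import Literature.Computability.Complexity.FKPointLocationCertificates
import HarnessLib

/-!
# Fournier–Koiran point location, I′: partial validity of certificates (levels below `j`)

Topic `Literature/Computability/Complexity`, grouping namespace `FKPointLocation`. Companion of
`FKPointLocationCertificates.lean`. While a location certificate is being BUILT level by level
(`FKPointLocationProtocol*.lean`), only the levels already produced are valid; the binary search of
the next level needs the projected point `x^{(j)}` to lie in the unit cube of its chart, which
depends on the exit data of the levels `< j` only. This file isolates that dependence:

* `Cert.ValidBelow Γ x̂ j` — the fields of `Cert.Valid` that concern levels `< j` and are needed
  for the cube invariant (`s_0 = 0`, apexes in their charts, exit facet data);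
  `Cert.Valid.validBelow`, `Cert.ValidBelow.mono`;
* `Cert.xProj_mem_unitCube_of_validBelow` — `x^{(j')}` lies in the unit cube of `χ_{j'}` for
  `1 ≤ j' ≤ j` (same proof as `Cert.xProj_mem_unitCube`), with `chart_trichotomy_of_validBelow`,
  `exit_facts_of_validBelow`;
* `Cert.Agree Γ Γ' j` (same apexes and exits below `j`) and the congruences `chart_congr`,
  `xProj_congr`, `ValidBelow.congr`: the projected points and charts of level `≤ j` depend only on
  the data below `j`.

## References

* H. Fournier, P. Koiran, *Lower bounds are not easier over the reals: inside PH*, ICALP 2000,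
  LNCS 1853 = LIP RR-1999-21, §2.1 (Step k uses only the tops and faces of steps `< k`).
  [FournierKoiran2000]
-/

namespace Literature.Computability.Complexity

namespace FKPointLocation

open Finset

variable {D : ℕ}

namespace Cert

variable {Γ Γ' : Cert D} {xh : Fin D → ℝ} {B : ℕ} {r : ℚ} {J' : ℕ}

/-- **Partial validity below level `J'`**: the level-0 apex is `0`, apexes of levels `1 ≤ j < J'`
lie in their charts, and the exit data of levels `j < J'` are correct (free exit coordinate, `ε*`
the sign of the direction, `i*` minimising the hitting parameter).
[cite: FournierKoiran2000, §2.1 (the data of steps `< k` used at step `k`)] -/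
structure ValidBelow (Γ : Cert D) (xh : Fin D → ℝ) (J' : ℕ) : Prop where
  /-- the level-0 apex is the origin -/
  s_zero : Γ.s 0 = 0
  /-- `s_j ∈ G_j` for `1 ≤ j < J'` -/
  s_fixed : ∀ j, 1 ≤ j → j < J' → ∀ i, Γ.chart j i ≠ 0 → Γ.s j i = Γ.chart j i
  /-- the exit coordinate is free -/
  exit_free : ∀ j < J', Γ.chart j (Γ.istar j) = 0
  /-- `ε*` is the sign of the direction at `i*` -/
  exit_sign : ∀ j < J',
    (0 < Γ.xProj xh j (Γ.istar j) - Γ.sR j (Γ.istar j) ∧ Γ.εstar j = 1) ∨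
    (Γ.xProj xh j (Γ.istar j) - Γ.sR j (Γ.istar j) < 0 ∧ Γ.εstar j = -1)
  /-- `i*` minimises the hitting parameter among moving free coordinates -/
  exit_min : ∀ j < J', ∀ i, Γ.chart j i = 0 →
    (0 < Γ.xProj xh j i - Γ.sR j i →
      Γ.exitParam xh j ≤ (1 - Γ.sR j i) / (Γ.xProj xh j i - Γ.sR j i)) ∧
    (Γ.xProj xh j i - Γ.sR j i < 0 →
      Γ.exitParam xh j ≤ (1 + Γ.sR j i) / (Γ.sR j i - Γ.xProj xh j i))

/-- A valid certificate is valid below its depth. [folklore] -/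
theorem Valid.validBelow (hV : Γ.Valid xh B r) : Γ.ValidBelow xh Γ.J where
  s_zero := hV.s_zero
  s_fixed j hj1 hj := hV.s_fixed j hj1 hj.le
  exit_free := hV.exit_free
  exit_sign := hV.exit_sign
  exit_min := hV.exit_min

/-- Partial validity is monotone in the level. [folklore] -/
theorem ValidBelow.mono (hV : Γ.ValidBelow xh J') {J'' : ℕ} (h : J'' ≤ J') : Γ.ValidBelow xh J'' where
  s_zero := hV.s_zero
  s_fixed j hj1 hj := hV.s_fixed j hj1 (by omega)
  exit_free j hj := hV.exit_free j (by omega)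
  exit_sign j hj := hV.exit_sign j (by omega)
  exit_min j hj := hV.exit_min j (by omega)

/-- The level-0 apex is `0`. [folklore] -/
theorem sR_zero_of_validBelow (hV : Γ.ValidBelow xh J') : Γ.sR 0 = 0 := by
  funext i; simp [sR, hV.s_zero]

/-- Apexes of levels `< J'` lie in their charts. [cite: FournierKoiran2000, §2.1] -/
theorem sR_fixed_of_validBelow (hV : Γ.ValidBelow xh J') {j : ℕ} (hj : j < J') {i : Fin D}
    (h : Γ.chart j i ≠ 0) : Γ.sR j i = Γ.chart j i := by
  rcases Nat.eq_zero_or_pos j with rfl | hpos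
  · simp at h
  · have := hV.s_fixed j hpos hj i h
    simp only [sR, this, Rat.cast_intCast]

/-- Chart values are `0, 1, -1` up to level `J'`. [folklore] -/
theorem chart_trichotomy_of_validBelow (hV : Γ.ValidBelow xh J') :
    ∀ j, j ≤ J' → ∀ i, Γ.chart j i = 0 ∨ Γ.chart j i = 1 ∨ Γ.chart j i = -1 := by
  intro j
  induction j with
  | zero => intro _ i; left; rfl
  | succ j ih =>
    intro hj i
    rw [chart_succ_apply]
    split_ifs with h
    · rcases hV.exit_sign j (by omega) with ⟨-, h1⟩ | ⟨-, h1⟩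
      · right; left; exact h1
      · right; right; exact h1
    · exact ih (by omega) i

/-- Exit facts for `j < J'` (as `Cert.exit_facts`). [cite: FournierKoiran2000, §2.1] -/
theorem exit_facts_of_validBelow (hV : Γ.ValidBelow xh J') {j : ℕ} (hj : j < J')
    (hc : 1 ≤ j → |Γ.xProj xh j (Γ.istar j)| ≤ 1) :
    Γ.xProj xh j (Γ.istar j) - Γ.sR j (Γ.istar j) ≠ 0 ∧
    (Γ.εstar j : ℝ) * (Γ.xProj xh j (Γ.istar j) - Γ.sR j (Γ.istar j)) =
      |Γ.xProj xh j (Γ.istar j) - Γ.sR j (Γ.istar j)| ∧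
    (Γ.εstar j : ℝ) * (Γ.εstar j : ℝ) = 1 ∧
    0 < 1 - (Γ.εstar j : ℝ) * Γ.sR j (Γ.istar j) ∧
    0 < Γ.exitParam xh j ∧ (1 ≤ j → 1 ≤ Γ.exitParam xh j) := by
  set y := Γ.xProj xh j (Γ.istar j) with hy
  set σ := Γ.sR j (Γ.istar j) with hσ
  have hσ0 : j = 0 → σ = 0 := by rintro rfl; rw [hσ, sR_zero_of_validBelow hV]; rfl
  have key : ∀ (ε : ℝ), (ε = 1 ∧ 0 < y - σ) ∨ (ε = -1 ∧ y - σ < 0) →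
      y - σ ≠ 0 ∧ ε * (y - σ) = |y - σ| ∧ ε * ε = 1 ∧ 0 < 1 - ε * σ ∧
      0 < (1 - ε * σ) / |y - σ| ∧ (1 ≤ j → 1 ≤ (1 - ε * σ) / |y - σ|) := by
    rintro ε (⟨rfl, hd⟩ | ⟨rfl, hd⟩)
    · have habs : |y - σ| = y - σ := abs_of_pos hd
      have hν : 0 < 1 - 1 * σ ∧ (1 ≤ j → y - σ ≤ 1 - 1 * σ) := by
        rcases Nat.eq_zero_or_pos j with h0 | hpos
        · refine ⟨by rw [hσ0 h0]; norm_num, fun h => by omega⟩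
        · have h1 : y ≤ 1 := (abs_le.1 (hc hpos)).2
          exact ⟨by linarith, fun _ => by linarith⟩
      refine ⟨hd.ne', by rw [habs, one_mul], by norm_num, hν.1, by rw [habs]; exact div_pos hν.1 hd,
        fun h1 => ?_⟩
      rw [habs, one_le_div hd]
      exact hν.2 h1
    · have habs : |y - σ| = -(y - σ) := abs_of_neg hd
      have hν : 0 < 1 - (-1) * σ ∧ (1 ≤ j → -(y - σ) ≤ 1 - (-1) * σ) := by
        rcases Nat.eq_zero_or_pos j with h0 | hpos
        · refine ⟨by rw [hσ0 h0]; norm_num, fun h => by omega⟩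
        · have h1 : -1 ≤ y := (abs_le.1 (hc hpos)).1
          exact ⟨by linarith, fun _ => by linarith⟩
      refine ⟨hd.ne, by rw [habs]; ring, by norm_num, hν.1,
        by rw [habs]; exact div_pos hν.1 (by linarith), fun h1 => ?_⟩
      rw [habs, one_le_div (by linarith)]
      exact hν.2 h1
  rcases hV.exit_sign j hj with ⟨hd, he⟩ | ⟨hd, he⟩
  · have := key 1 (Or.inl ⟨rfl, hd⟩)
    simp only [exitParam, he, Int.cast_one, ← hy, ← hσ]
    exact this
  · have := key (-1) (Or.inr ⟨rfl, hd⟩)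
    simp only [exitParam, he, Int.cast_neg, Int.cast_one, ← hy, ← hσ]
    exact this

/-- One pyramid step keeps the point in the unit cube (partial-validity form of
`Cert.xProj_succ_mem`). [cite: FournierKoiran2000, §2.1] -/
theorem xProj_succ_mem_of_validBelow (hV : Γ.ValidBelow xh J') {j : ℕ} (hj : j < J')
    (hfix : ∀ i, Γ.chart j i ≠ 0 → Γ.xProj xh j i = Γ.chart j i)
    (hcube : 1 ≤ j → ∀ i, |Γ.xProj xh j i| ≤ 1) :
    (∀ i, Γ.chart (j + 1) i ≠ 0 → Γ.xProj xh (j + 1) i = Γ.chart (j + 1) i) ∧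
    ∀ i, |Γ.xProj xh (j + 1) i| ≤ 1 := by
  obtain ⟨hd0, hεd, hεε, hν, hcpos, hc1⟩ := exit_facts_of_validBelow hV hj (fun h => hcube h _)
  set c := Γ.exitParam xh j with hc
  set y := Γ.xProj xh j with hy
  set s := Γ.sR j with hs
  set i₀ := Γ.istar j with hi₀
  set ε : ℝ := (Γ.εstar j : ℝ) with hε
  have hs0 : j = 0 → s = 0 := by rintro rfl; exact sR_zero_of_validBelow hV
  have hstep : ∀ i, Γ.xProj xh (j + 1) i = s i + c * (y i - s i) := by
    intro i; rw [xProj_succ]; rfl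
  have hε0 : ε ≠ 0 := by
    intro h0; rw [h0, mul_zero] at hεε; exact zero_ne_one hεε
  have hi₀val : Γ.xProj xh (j + 1) i₀ = ε := by
    have h1 : c * (y i₀ - s i₀) = (1 - ε * s i₀) * ε := by
      rw [hc, exitParam, ← hy, ← hs, ← hi₀, ← hε, ← hεd, div_mul_eq_mul_div,
        mul_div_mul_right _ _ hd0, div_eq_iff hε0, mul_assoc, hεε, mul_one]
    rw [hstep, h1]
    linear_combination (-(s i₀)) * hεε
  have hεabs : |ε| = 1 := by
    rcases hV.exit_sign j hj with ⟨-, h1⟩ | ⟨-, h1⟩ <;> simp [hε, h1]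
  have hfixed : ∀ i, Γ.chart j i ≠ 0 → Γ.xProj xh (j + 1) i = Γ.chart j i := by
    intro i hi
    have h1 : y i = Γ.chart j i := hfix i hi
    have h2 : s i = Γ.chart j i := sR_fixed_of_validBelow hV hj hi
    rw [hstep, h1, h2]; ring
  refine ⟨fun i hi => ?_, fun i => ?_⟩
  · rw [chart_succ_apply] at hi ⊢
    split_ifs at hi ⊢ with h
    · rw [h]; exact hi₀val
    · exact hfixed i hi
  · by_cases h : i = i₀
    · rw [h, hi₀val, hεabs]
    by_cases hfree : Γ.chart j i = 0
    · have hmin := hV.exit_min j hj i hfree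
      rw [← hy, ← hs, ← hc] at hmin
      rw [hstep]
      rcases lt_trichotomy (y i - s i) 0 with hneg | hzero | hpos
      · have hle : c ≤ (1 + s i) / (s i - y i) := hmin.2 hneg
        have hlow : -1 ≤ s i + c * (y i - s i) := by
          have h1 : c * (s i - y i) ≤ 1 + s i := by
            rwa [le_div_iff₀ (by linarith)] at hle
          linarith
        have hup : s i + c * (y i - s i) ≤ 1 := by
          rcases Nat.eq_zero_or_pos j with h0 | hpos'
          · have : s i = 0 := by rw [hs0 h0]; rfl
            rw [this]; nlinarith
          · have h1 : y i ≤ 1 := (abs_le.1 (hcube hpos' i)).2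
            have h2 : 1 ≤ c := hc1 hpos'
            nlinarith
        exact abs_le.2 ⟨hlow, hup⟩
      · rw [hzero, mul_zero, add_zero]
        rcases Nat.eq_zero_or_pos j with h0 | hpos'
        · have : s i = 0 := by rw [hs0 h0]; rfl
          rw [this]; simp
        · have : s i = y i := by linarith
          rw [this]; exact hcube hpos' i
      · have hle : c ≤ (1 - s i) / (y i - s i) := hmin.1 hpos
        have hup : s i + c * (y i - s i) ≤ 1 := by
          have h1 : c * (y i - s i) ≤ 1 - s i := by rwa [le_div_iff₀ hpos] at hle
          linarith
        have hlow : -1 ≤ s i + c * (y i - s i) := by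
          rcases Nat.eq_zero_or_pos j with h0 | hpos'
          · have : s i = 0 := by rw [hs0 h0]; rfl
            rw [this]; nlinarith
          · have h1 : -1 ≤ y i := (abs_le.1 (hcube hpos' i)).1
            have h2 : 1 ≤ c := hc1 hpos'
            nlinarith
        exact abs_le.2 ⟨hlow, hup⟩
    · rw [hfixed i hfree]
      rcases chart_trichotomy_of_validBelow hV j hj.le i with h0 | h1 | h1
      · exact absurd h0 hfree
      · simp [h1]
      · simp [h1]

/-- **The projected points of levels `1 ≤ j ≤ J'` lie in the unit cubes of their charts**, under
partial validity below `J'`. [cite: FournierKoiran2000, §2.1] -/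
theorem xProj_mem_unitCube_of_validBelow (hV : Γ.ValidBelow xh J') :
    ∀ j, j ≤ J' → (∀ i, Γ.chart j i ≠ 0 → Γ.xProj xh j i = Γ.chart j i) ∧
      (1 ≤ j → ∀ i, |Γ.xProj xh j i| ≤ 1) := by
  intro j
  induction j with
  | zero => intro _; exact ⟨fun i h => absurd rfl h, fun h => absurd h (by omega)⟩
  | succ j ih =>
    intro hj
    have h := xProj_succ_mem_of_validBelow hV (by omega) (ih (by omega)).1 (ih (by omega)).2
    exact ⟨h.1, fun _ => h.2⟩

/-! ### Agreement below a level -/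

/-- Two certificates AGREE below `j`: same apexes and exit data at levels `< j`. [folklore] -/
def Agree (Γ Γ' : Cert D) (j : ℕ) : Prop :=
  ∀ j' < j, Γ.s j' = Γ'.s j' ∧ Γ.istar j' = Γ'.istar j' ∧ Γ.εstar j' = Γ'.εstar j'

/-- Agreement is monotone. [folklore] -/
theorem Agree.mono {j j' : ℕ} (h : Agree Γ Γ' j) (hj : j' ≤ j) : Agree Γ Γ' j' :=
  fun k hk => h k (by omega)

/-- Agreement is symmetric. [folklore] -/
theorem Agree.symm {j : ℕ} (h : Agree Γ Γ' j) : Agree Γ' Γ j :=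
  fun k hk => ⟨(h k hk).1.symm, (h k hk).2.1.symm, (h k hk).2.2.symm⟩

/-- Charts of level `≤ j` depend only on the data below `j`. [folklore] -/
theorem chart_congr {j : ℕ} (h : Agree Γ Γ' j) : ∀ j' ≤ j, Γ.chart j' = Γ'.chart j' := by
  intro j'
  induction j' with
  | zero => intro _; rfl
  | succ j' ih =>
    intro hj
    funext i
    rw [chart_succ_apply, chart_succ_apply, ih (by omega), (h j' (by omega)).2.1, (h j' (by omega)).2.2]

/-- Projected points of level `≤ j` depend only on the data below `j`. [folklore] -/
theorem xProj_congr {j : ℕ} (h : Agree Γ Γ' j) : ∀ j' ≤ j, Γ.xProj xh j' = Γ'.xProj xh j' := by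
  intro j'
  induction j' with
  | zero => intro _; rfl
  | succ j' ih =>
    intro hj
    obtain ⟨hs, hi, he⟩ := h j' (by omega)
    have hsR : Γ.sR j' = Γ'.sR j' := by funext k; simp [sR, hs]
    rw [xProj_succ, xProj_succ, exitParam, exitParam, ih (by omega), hsR, hi, he]

/-- Partial validity transfers along agreement. [folklore] -/
theorem ValidBelow.congr (hV : Γ.ValidBelow xh J') (h : Agree Γ Γ' J') (h0 : 0 < J') :
    Γ'.ValidBelow xh J' where
  s_zero := by rw [← (h 0 h0).1]; exact hV.s_zero
  s_fixed j hj1 hj i hi := by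
    have hc := chart_congr h j hj.le
    rw [← hc] at hi ⊢
    rw [← (h j hj).1]
    exact hV.s_fixed j hj1 hj i hi
  exit_free j hj := by
    rw [← chart_congr h j hj.le, ← (h j hj).2.1]; exact hV.exit_free j hj
  exit_sign j hj := by
    obtain ⟨hs, hi, he⟩ := h j hj
    have hsR : Γ.sR j = Γ'.sR j := by funext k; simp [sR, hs]
    rw [← xProj_congr h j hj.le, ← hsR, ← hi, ← he]
    exact hV.exit_sign j hj
  exit_min j hj i hi := by
    obtain ⟨hs, hi', he⟩ := h j hj
    have hsR : Γ.sR j = Γ'.sR j := by funext k; simp [sR, hs]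
    have hx := xProj_congr (xh := xh) h j hj.le
    have hex : Γ'.exitParam xh j = Γ.exitParam xh j := by
      rw [exitParam, exitParam, hx, hsR, hi', he]
    rw [← chart_congr h j hj.le] at hi
    rw [← hx, ← hsR, hex]
    exact hV.exit_min j hj i hi

end Cert

end FKPointLocation

end Literature.Computability.Complexity
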